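import Summits.Ventures.AbcSig.Rows.XTemplateC2a
import Summits.Ventures.AbcSig.Rows.C2aL181A0S

/-!
# Venture AbcSig — ROW `C2aL181A0SAB`: `181^m·xⁿ + yⁿ = z²` (second distribution, by symmetry), class `a = 0`, over the level files 5792 (ordinary tree certificates) and 362 (ordinary tree certificates) (GENERATED by p-lean g5 `gen5/c2arow4.py`)

HONEST FRAMING. A row of a COMPUTATION cell (`pub-abcsig`); a CONDITIONAL theorem, no claim on ABC or any summit.
Hypotheses: `BS04Package` (CITED: [BS04] Lemma 3.3 + (3.1) + Lemma 4.2); `DataComplete` at both levels and `RefinesCPSymAll` at the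
norm-form level(s) (COMPUTED: certified engine-1 level files; `Sieve/CharpolyCert.lean` / `Sieve/CharpolyTwist.lean`); `EisPackage` (CITED) + `Refines` (COMPUTED) for module-M6 residues discharged IN THE KERNEL at level 362; KERNEL SIEVE DISCHARGES on re-based presentations (`Levels/N…RB.lean`, `Recipes/SieveDischarge.lean`) under the COMPUTED hypotheses `hRB_… : ∀ f, Matches f orbit → Matches f rb` for the pairs 5792.11 @ 31;
and the listed per-orbit exclusions `hX_…` (CITED: the row of record's module closures — M4 Kraus / M6 / M8 / [BS04, Prop 4.4/4.6] as its R3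
names them; nothing of those is checked here). Exponent range: prime `n ≥ 11`, `n ≠ 181`; `B = 2^0·181^m`, `1 ≤ m < n`
(RULING H1 reduced exponents).
S-variant (p-lean g5): same statement as Rows/C2aL181A0X.lean; the residual pair(s) 5792:11:31 (N:orbit:n), closed in the row of record by the certified prime-ideal sieve (no module), are discharged IN THE KERNEL on a re-based presentation (Levels/N5792RB.lean) instead of being cited.
Row of record: `census/rows/C2a/C2a-l181-a0.md` (sha16 `72094e0763c37ae4`; row of record R8-signed (see its R8 cell)).
-/

namespace Summit.Ventures.AbcSig

/-- Row `C2aL181A0SAB`: `a = 0`, second distribution `(181^m, 1)` — the first with `x, y` swapped (`IsPrimitiveSolution.swap`). -/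
theorem xrow_C2aL181A0SAB (M : NewformModel) (hP : M.BS04Package)
    (hE : M.EisPackage)
    (hR_orbit_362_5 : M.Refines 362 orbit_362_5 m6X_362_5)
    (hRB_orbit_5792_11 : ∀ f : M.Form 5792, M.Matches f orbit_5792_11 → M.Matches f rb_5792_11)
    (hD5792 : M.DataComplete 5792 level5792Orbits)
    (hD362 : M.DataComplete 362 level362Orbits)
    (n : ℕ) (hn : n.Prime) (hmin : 11 ≤ n) (hnℓ : n ≠ 181) (m : ℕ) (hm : 1 ≤ m) (hmn : m < n)
    (hX_orbit_5792_11 : n ∈ ([41] : List ℕ) → M.Excludes 5792 orbit_5792_11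
      (famB (2 ^ 0 * 181 ^ m) n (fun _ _ => True)))
    (x y z : ℤ) (hxy1 : x * y ≠ 1) (hxy2 : x * y ≠ -1) : ¬ IsPrimitiveSolution (181 ^ m) (2 ^ 0) 1 n x y z := by
  intro h
  have h' : IsPrimitiveSolution 1 (2 ^ 0 * 181 ^ m) 1 n y x z := by simpa only [pow_zero, one_mul] using h.swap
  exact xrow_C2aL181A0S M hP hE hR_orbit_362_5 hRB_orbit_5792_11 hD5792 hD362 n hn hmin hnℓ m hm hmn hX_orbit_5792_11 y x z (by rwa [mul_comm]) (by rwa [mul_comm]) h'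

end Summit.Ventures.AbcSig
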